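import Summits.QuantumFields.YangMills.Theorems.BalabanLadderUVSeamRecCeilingsDLRPeelingLinearBudgetSlices
import HarnessLib

/-!
# Crux `UVSeamRec` (stmt-QuantumFields-20043), lane B: arithmetic of the deep zone of the GUARDED peeling assembly

Helper file (`--supports stmt-QuantumFields-20043`) of the width-lever seat `ym-20043-ceilings-p2` (lane B, gen 9); bookkeeping lemmas for the
sequel `…CeilingsGuardedPeelingBudget` (doubled exponential moments of the influence functionals from the GUARDED one-box bound (GUCR)):
* `integral_exp_le_exp_of_le` — `∫exp(c f) ≤ exp(c M)` for `f ≤ M`, `c ≥ 0` on a probability space;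
* `sched_pow` — the threshold schedule along a parent chain: `ε(k+s) ≤ ρ ε(k)` for all `k` gives `ε(k+js) ≤ ρ^j ε(k)`;
* `mul_two_div_pow_le_one`, `guarded_deep_small` — at depth `d ≥ m + 4 + 2Js + J` below the top shell level the linearisation condition
  `16·b^{4(j+1)s}·256(2m+4)⁴·J·2^{d+2}·a ≤ 1` holds under gen 8's level cap (`levelCap_le_inv_pow`, `deep_small`);
* `guarded_deep_fits` — at depth `d ≥ m + 4 + Js` every parent level `k + (j+1)s`, `j < J`, has a collar cube that fits in the torus and a period
  window with room (`deep_fits`);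
* `sum_shift_window_le` — shifted level windows of a nonnegative sequence.
HONEST FRAMING: elementary real arithmetic; nothing of E0′; not a gap, not Clay.  References: folklore.
-/

set_option autoImplicit false

noncomputable section

open MeasureTheory Filter Topology Finset
open Literature.MathematicalPhysics.QuantumLattice (integrable_of_abs_le)

namespace Summit.QuantumFields.YangMills.Cruxes.UVSeamRec.DLRPeeling

open Summit.QuantumFields.YangMills.Cruxes.UVSeamRec.PolymerData

section Bookkeeping

/-- If `f ≤ M` pointwise (measurable) on a probability space and `c ≥ 0`, then `∫exp(c·f) ≤ exp(c·M)`. [folklore] -/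
theorem integral_exp_le_exp_of_le {Ω : Type*} [MeasurableSpace Ω] (μ : Measure Ω) [IsProbabilityMeasure μ]
    {f : Ω → ℝ} (hfm : Measurable f) {M c : ℝ} (hf : ∀ ω, f ω ≤ M) (hc : 0 ≤ c) :
    ∫ ω, Real.exp (c * f ω) ∂μ ≤ Real.exp (c * M) := by
  have hpt : ∀ ω, Real.exp (c * f ω) ≤ Real.exp (c * M) := fun ω => Real.exp_le_exp.2 (mul_le_mul_of_nonneg_left (hf ω) hc)
  calc ∫ ω, Real.exp (c * f ω) ∂μ ≤ ∫ _ω, Real.exp (c * M) ∂μ :=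
        integral_mono (integrable_of_abs_le (hfm.const_mul c).exp (C := Real.exp (c * M)) fun ω => by
          rw [Real.abs_exp]; exact hpt ω) (integrable_const _) hpt
    _ = Real.exp (c * M) := by rw [integral_const, smul_eq_mul, probReal_univ, one_mul]

/-- **The schedule along a chain**: if `ε(k+s) ≤ ρ·ε(k)` for all `k` and `ρ ≥ 0` then `ε(k + js) ≤ ρ^j·ε(k)`. [folklore] -/
theorem sched_pow {ε : ℕ → ℝ} {ρ : ℝ} (hρ : 0 ≤ ρ) {s : ℕ} (hs : ∀ k, ε (k + s) ≤ ρ * ε k) (k j : ℕ) :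
    ε (k + j * s) ≤ ρ ^ j * ε k := by
  induction j with
  | zero => simp
  | succ j ih =>
    calc ε (k + (j + 1) * s) = ε (k + j * s + s) := by ring_nf
      _ ≤ ρ * ε (k + j * s) := hs _
      _ ≤ ρ * (ρ ^ j * ε k) := mul_le_mul_of_nonneg_left ih hρ
      _ = ρ ^ (j + 1) * ε k := by rw [pow_succ]; ring





/-- `J·(2/81)^J ≤ 1`. [folklore] -/
theorem mul_two_div_pow_le_one (J : ℕ) : (J : ℝ) * ((2 : ℝ) / 81) ^ J ≤ 1 := by
  have hJ : (J : ℝ) ≤ (2 : ℝ) ^ J := by exact_mod_cast Nat.lt_two_pow_self.le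
  calc (J : ℝ) * ((2 : ℝ) / 81) ^ J ≤ (2 : ℝ) ^ J * ((2 : ℝ) / 81) ^ J :=
        mul_le_mul_of_nonneg_right hJ (by positivity)
    _ = ((4 : ℝ) / 81) ^ J := by rw [← mul_pow]; norm_num
    _ ≤ 1 := pow_le_one₀ (by norm_num) (by norm_num)

/-- **The deep zone is linearisable.**  For `b ≥ 3`, `m ≥ 3`, `J` chain steps of depth `s`, at depth `d ≥ m + 4 + 2Js + J` below the top shell
level (`2b^K ≤ R`, `k + d = K`), a coefficient `0 ≤ a` under the level cap satisfies, for every `j < J`,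
`16·b^{4(j+1)s}·256(2m+4)⁴·(J·(2^{d+1}·2·a)) ≤ 1` (`levelCap_le_inv_pow`, `deep_small`, `J(2/81)^J ≤ 1`, `(4/b⁴)^{Js} ≤ 1`). [folklore] -/
theorem guarded_deep_small (𝔟 : BlockSize) {m R K k d s J j : ℕ} (hm : 3 ≤ m) (hK : 2 * 𝔟.b ^ K ≤ R) (hkd : k + d = K)
    (hd : m + 4 + 2 * J * s + J ≤ d) (hj : j < J) {a : ℝ} (ha0 : 0 ≤ a)
    (ha : a ≤ 16 * ((𝔟.b : ℝ) ^ k / ((R : ℝ) + 2 + 2 * (𝔟.b : ℝ) ^ k)) ^ 4) :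
    16 * ((𝔟.b : ℝ) ^ ((j + 1) * s)) ^ 4 * (256 * (2 * (m : ℝ) + 4) ^ 4) * ((J : ℝ) * ((2 : ℝ) ^ (d + 1) * 2 * a)) ≤ 1 := by
  have hb3 : (3 : ℝ) ≤ (𝔟.b : ℝ) := by exact_mod_cast BlockFieldLocality.three_le_b 𝔟
  have hb0 : (0 : ℝ) < (𝔟.b : ℝ) := by linarith
  have hb1 : (1 : ℝ) ≤ (𝔟.b : ℝ) := by linarith
  have hcap := ha.trans (levelCap_le_inv_pow 𝔟 hK hkd)
  have f1 := deep_small 𝔟 hm (le_refl (m + 4))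
  set x : ℝ := (𝔟.b : ℝ) ^ 4 with hx
  have hx81 : (81 : ℝ) ≤ x := by
    have h := pow_le_pow_left₀ (by norm_num : (0 : ℝ) ≤ 3) hb3 4
    norm_num at h
    rw [hx]; exact h
  have hx0 : 0 < x := by linarith
  have hx1 : 1 ≤ x := by linarith
  set K' : ℝ := 256 * (2 * (m : ℝ) + 4) ^ 4 with hK'
  have hK'0 : 0 ≤ K' := by rw [hK']; positivity
  set q : ℝ := 2 / x with hq
  have hq0 : 0 ≤ q := by rw [hq]; positivity
  have hq1 : q ≤ 1 := by rw [hq, div_le_one hx0]; linarith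
  have hq81 : q ≤ 2 / 81 := by rw [hq]; exact div_le_div_of_nonneg_left (by norm_num) (by norm_num) hx81
  have hJ0 : (0 : ℝ) ≤ J := Nat.cast_nonneg J
  obtain ⟨r, hr⟩ := Nat.exists_eq_add_of_le hd
  -- Step A: replace `b^{4(j+1)s}` by `x^{Js}` and `a` by its cap `1/x^d`
  have hBj : ((𝔟.b : ℝ) ^ ((j + 1) * s)) ^ 4 ≤ x ^ (J * s) := by
    have e : ((𝔟.b : ℝ) ^ ((j + 1) * s)) ^ 4 = x ^ ((j + 1) * s) := by
      rw [hx, ← pow_mul, ← pow_mul, mul_comm]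
    rw [e]
    exact pow_le_pow_right₀ hx1 (Nat.mul_le_mul_right s hj)
  have hA : 16 * ((𝔟.b : ℝ) ^ ((j + 1) * s)) ^ 4 * K' * ((J : ℝ) * ((2 : ℝ) ^ (d + 1) * 2 * a)) ≤
      16 * x ^ (J * s) * K' * ((J : ℝ) * ((2 : ℝ) ^ (d + 1) * 2 * (1 / x ^ d))) := by
    have h1 : 16 * ((𝔟.b : ℝ) ^ ((j + 1) * s)) ^ 4 * K' ≤ 16 * x ^ (J * s) * K' :=
      mul_le_mul_of_nonneg_right (mul_le_mul_of_nonneg_left hBj (by norm_num)) hK'0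
    have h2 : (J : ℝ) * ((2 : ℝ) ^ (d + 1) * 2 * a) ≤ (J : ℝ) * ((2 : ℝ) ^ (d + 1) * 2 * (1 / x ^ d)) :=
      mul_le_mul_of_nonneg_left (mul_le_mul_of_nonneg_left hcap (by positivity)) hJ0
    exact mul_le_mul h1 h2 (by positivity) (by positivity)
  refine hA.trans ?_
  -- Step B: `2^{d+1}·2/x^d = 4q^d` and the factorisation along `d = (m+4) + 2Js + J + r`
  have hQ : (2 : ℝ) ^ (d + 1) * 2 * (1 / x ^ d) = 4 * q ^ d := by
    rw [hq, div_pow, pow_succ]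
    field_simp
    ring
  rw [hQ, hr]
  have e1 : 16 * x ^ (J * s) * K' * ((J : ℝ) * (4 * q ^ (m + 4 + 2 * J * s + J + r))) =
      (64 * K' * q ^ (m + 4)) * ((J : ℝ) * q ^ J) * ((x * q ^ 2) ^ (J * s)) * q ^ r := by
    ring
  rw [e1]
  have f1' : 64 * K' * q ^ (m + 4) ≤ 1 := by simpa only [hK', hq, hx] using f1
  have f2 : (J : ℝ) * q ^ J ≤ 1 :=
    (mul_le_mul_of_nonneg_left (pow_le_pow_left₀ hq0 hq81 J) hJ0).trans (mul_two_div_pow_le_one J)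
  have hxq : x * q ^ 2 ≤ 1 := by
    rw [hq, div_pow, mul_div_assoc', div_le_one (by positivity)]
    nlinarith [hx81]
  have f3 : (x * q ^ 2) ^ (J * s) ≤ 1 := pow_le_one₀ (by positivity) hxq
  have f4 : q ^ r ≤ 1 := pow_le_one₀ hq0 hq1
  exact mul_le_one₀ (mul_le_one₀ (mul_le_one₀ f1' (by positivity) f2) (by positivity) f3) (pow_nonneg hq0 r) f4

/-- **Deep parents fit.**  If `2b^K ≤ R`, `4R+8 ≤ L`, `k + d = K`, `m + 4 + J·s ≤ d` and `j < J`, then the parent level `k + (j+1)s` has depth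
`≥ m + 4`, so its collar cube fits (`deep_fits`) and `L + 2R + 2 + 2b^{k+(j+1)s} ≤ 2L+1`. [folklore] -/
theorem guarded_deep_fits (𝔟 : BlockSize) {m R L K k d s J j : ℕ} (hm : 3 ≤ m) (hK : 2 * 𝔟.b ^ K ≤ R) (hRL : 4 * R + 8 ≤ L)
    (hkd : k + d = K) (hd : m + 4 + J * s ≤ d) (hj : j < J) :
    (2 * m + 1) * 𝔟.b ^ (k + (j + 1) * s) + 3 ≤ 2 * L + 1 ∧
      (L : ℤ) + 2 * R + 2 + 2 * (𝔟.b : ℤ) ^ (k + (j + 1) * s) ≤ 2 * L + 1 := by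
  have hjs : (j + 1) * s ≤ J * s := Nat.mul_le_mul_right s hj
  have hdepth : m + 4 ≤ K - (k + (j + 1) * s) := by omega
  have hsum : (k + (j + 1) * s) + (K - (k + (j + 1) * s)) = K := by omega
  refine ⟨deep_fits 𝔟 hK hRL hsum hdepth, ?_⟩
  -- `b^{k+(j+1)s} ≤ b^K ≤ R/2`
  have h1 : 𝔟.b ^ (k + (j + 1) * s) ≤ 𝔟.b ^ K := Nat.pow_le_pow_right 𝔟.pos (by omega)
  have h2 : 2 * 𝔟.b ^ (k + (j + 1) * s) ≤ R := (Nat.mul_le_mul_left 2 h1).trans hK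
  have h3 : (2 : ℤ) * (𝔟.b : ℤ) ^ (k + (j + 1) * s) ≤ R := by exact_mod_cast h2
  have h4 : (4 : ℤ) * R + 8 ≤ L := by exact_mod_cast hRL
  linarith



/-- **Shifted level windows**: for `g ≥ 0` on `ℕ`, `Σ_{i<K} g(i + 1 + t) ≤ Σ_{l < K + 1 + t} g l`. [folklore] -/
theorem sum_shift_window_le (g : ℕ → ℝ) (hg : ∀ l, 0 ≤ g l) (K t : ℕ) :
    ∑ i ∈ Finset.range K, g (i + 1 + t) ≤ ∑ l ∈ Finset.range (K + 1 + t), g l := by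
  classical
  rw [← Finset.sum_image (f := g) (s := Finset.range K) (g := fun i => i + 1 + t) (fun i _ i' _ h => by dsimp only at h; omega)]
  refine Finset.sum_le_sum_of_subset_of_nonneg (fun l hl => ?_) fun l _ _ => hg l
  obtain ⟨i, hi, rfl⟩ := Finset.mem_image.1 hl
  exact Finset.mem_range.2 (by have := Finset.mem_range.1 hi; omega)

end Bookkeeping


end Summit.QuantumFields.YangMills.Cruxes.UVSeamRec.DLRPeeling

end
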